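import Summits.NavierStokesRegularity.NavierStokesRegularity.Theorems.ScenarioCensusRowF1ax
import Summits.NavierStokesRegularity.NavierStokesRegularity.Theorems.ScenarioCensusRowA7h
import Summits.NavierStokesRegularity.NavierStokesRegularity.Theorems.DssFarFieldSlavingBlowupTypeIDssProfileSimilarityEnstrophyBeltramiLiouville
import Summits.NavierStokesRegularity.NavierStokesRegularity.Theorems.SqueezeCycleSingularZoomWindow
import Summits.NavierStokesRegularity.NavierStokesRegularity.Theorems.ClockStretchingLawClockCeilingZoomDerivLimit
import Summits.NavierStokesRegularity.NavierStokesRegularity.Theorems.PoloidalWindowDoorPoloidalWindowRigidityVorticityTranslate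
import Literature.Analysis.FluidPDE.TypeIAncientMild
import Literature.Analysis.FluidPDE.WholeSpaceIBP
import Literature.Analysis.FluidPDE.ClassicalSolutionCalculus
import Literature.Analysis.FluidPDE.VorticityEquation
import Literature.Analysis.FluidPDE.TypeIAncientMildClassical
import HarnessLib
import Summits.NavierStokesRegularity.NavierStokesRegularity.Theorems.ScenarioCensusRowF1IntQuenchTop

/-!
# Census row F1, family «DYNAMIC TOP / one-sided Lagrangian» — the QUENCHED member (cells F1qnq / F1qn, ancient rows A-ni / A-qnq, floor IT) — LINE 21 «quenched-top» port,
# part 1/3: §1 the quench defect and its kinematic / joint forms (`HasQuenchDefectAt`, `HasStretchDefectAt`, `HasJointDefect₆At`, the vorticity-equation dictionary);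
# §2–§4 (frame, zoom calculus, singular-zoom package, THE KILL for non-intensifying vorticity) are shared VERBATIM with the landed integrated-quench / inviscid-top /
# frozen-top ports and are taken BY NAME (`open …IntegratedQuench`; not re-declared)

Re-homed for the scenario census (typer seat ns-census-typer-1 g9; the cells F1qnq / F1qn, the ancient rows A-ni / A-qnq and the floor IT are MEMBERS OF RECORD «DECIDED
IN KERNEL IN FILES» of row F1 since census v1.77 (critic backstop idea-crit-7 PASS 02:53Z; ref ns-census-ref g10 PRE-CHECK ✓ §15.15 item 39; lead-presearch label);
this port makes them TREE-decided): VERBATIM PORT of the NEW declarations of ns-idea-3 LINE 21 «quenched-top»,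
`pub/ideators/ns-idea-3/lines/quenched-top/line-quenched-top.lean` sha16 1fb0c3b1193b8625 (1967 l., lean check rc 0, 0 sorry; its §2–§4 and the frame of §1 are shared
VERBATIM with LINES 18/20/22/23 and taken BY NAME from the landed `ScenarioCensusRowF1IntQuench*` / `…Inviscid*` / `…Frozen*` / `…IntStretch*` ports — 101 declarations
not re-declared), split for the 400-line rule into `ScenarioCensusRowF1Quenched` (§1) → `…QuenchedTransfer` (§5–§6) → `…QuenchedTop` (§7 + census KEYS).  Lean text
VERBATIM in namespace `…Theorems.ScenarioCensus.QuenchedTop` (the line's `…Cruxes.ScenarioCensusRowF1.QuenchedTopLine` re-homed) with `open …IntegratedQuench`; port edits: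
`@[conjecture]` on the residual `QuenchSlack` (≡ `ScenarioCensus.Row_F1`, OPEN), one-line docstrings added where missing (gate lint); `vort_eq` is the frozen-top port's
`freeze_eq` and `norm_laplacian_curl_le` (used only inside the shared kill) is not re-declared.  Statements untouched.

No census VALUE is moved here (row F1 stays OPEN-WITH-LINE; the members become TREE-decided by name); NS regularity is NOT proved; `Row_F1` is untouched (zero
movement, `quenchSlack_iff_rowF1`); no summit statement is proved by this file. Lemmas that restate already-landed tree declarations are taken BY NAME (gate lint `dedup.landed`): `vort_eq` = `FrozenTop.freeze_eq`.
-/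

-- the summit and its single problem share the name `NavierStokesRegularity` (D-0017 nested layout)
set_option linter.dupNamespace false

noncomputable section

open MeasureTheory Set Function Filter TopologicalSpace Metric
open scoped Topology NNReal ENNReal InnerProductSpace RealInnerProductSpace Laplacian

namespace Summit.NavierStokesRegularity.NavierStokesRegularity.Theorems.ScenarioCensus.QuenchedTop

open Literature.Analysis Literature.Analysis.FluidPDE
open Summit.NavierStokesRegularity.NavierStokesRegularity.Theorems
open Summit.NavierStokesRegularity.NavierStokesRegularity.Theorems.ScenarioCensus.IntegratedQuench

/-- `ℝ³`. -/
abbrev E3 := EuclideanSpace ℝ (Fin 3)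

/-! ## §1 Levels, the dimensionless Type-I constant; the third-order datum and the INTENSIFICATION read-out
`⟪ω, Δω + (ω·∇)v⟫ = ½ D|ω|²`; the QUENCH defect (dynamic, pressure-free, one-sided) and its kinematic form; the
vorticity-equation dictionary -/

/-- Elementary: for `w > 0`, `ε ≥ 0`: `w · max 0 z ≤ ε ↔ w · z ≤ ε`. -/
theorem mul_max_le_iff {w ε z : ℝ} (hw : 0 < w) (hε : 0 ≤ ε) : w * max 0 z ≤ ε ↔ w * z ≤ ε := by
  constructor
  · exact fun h => (mul_le_mul_of_nonneg_left (le_max_right 0 z) hw.le).trans h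
  · intro h
    rcases le_total 0 z with hz | hz
    · rwa [max_eq_right hz]
    · rw [max_eq_left hz, mul_zero]; exact hε

/-! ### The quench defect and its kinematic / joint forms -/

/-- **ε-QUENCHED TOP** (material-intensification defect, DYNAMIC form — no pressure in the number): eventually, at
every `Λ t`-fast point, `(T − t)³ ⟪ω, ∂ₜω + (u·∇)ω⟫ ≤ ε` (`ω = curl u`; `∂ₜ` within `[0, T)`, the convention of
`IsClassicalNSSolutionOn (Ico 0 T)`; `vorticity u t = curl (u t)`): HALF THE MATERIAL RATE `½ Dₜ|ω|²`, `Dₜ = ∂ₜ + u·∇`,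
of the enstrophy density of the fast fluid is at most an `ε`-fraction of the Type-I enstrophy-rate scale `(T − t)⁻³`.
ONE-SIDED: arbitrary DECAY of `|ω|` along the particle paths is free; only INTENSIFICATION is charged. -/
def HasQuenchDefectAt (T : ℝ) (Λ : ℝ → ℝ) (ε : ℝ) (u : ℝ → E3 → E3) : Prop :=
  ∀ᶠ t in 𝓝[<] T, ∀ x : E3, Λ t < ‖u t x‖ →
    (T - t) ^ 3 * ⟪curl (u t) x, timeDerivWithin (Ico 0 T) (vorticity u) t x + convect (u t) (curl (u t)) x⟫ ≤ ε

/-- Kinematic form (STRETCHING-vs-DIFFUSION defect): `(T − t)³ ⟪ω, ν Δω + (ω·∇)u⟫ ≤ ε` at the fast points — the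
vortex-stretching gain `⟪ω, S ω⟫` exceeds the diffusive quench `−⟪ω, νΔω⟫` by at most `ε (T − t)⁻³`. -/
def HasStretchDefectAt (T : ℝ) (Λ : ℝ → ℝ) (ν ε : ℝ) (u : ℝ → E3 → E3) : Prop :=
  ∀ᶠ t in 𝓝[<] T, ∀ x : E3, Λ t < ‖u t x‖ →
    (T - t) ^ 3 * ⟪curl (u t) x, ν • (Δ (curl (u t))) x + convect (curl (u t)) (u t) x⟫ ≤ ε

/-- **Generic joint defect of weight 6** of a read-out `Rd(v, L, H, K)` of (value, gradient, Hessian, third-order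
datum), `ν`-normalised: `(ν (T − t))³ · Rd(u/ν, ∇u/ν, ∇²u/ν, K/ν) ≤ ε` at the fast points, eventually. -/
def HasJointDefect₆At (T : ℝ) (Λ : ℝ → ℝ) (ν ε : ℝ) (Rd : E3 → (E3 →L[ℝ] E3) → Hess → (E3 →L[ℝ] E3) → ℝ)
    (u : ℝ → E3 → E3) : Prop :=
  ∀ᶠ t in 𝓝[<] T, ∀ x : E3, Λ t < ‖u t x‖ →
    (ν * (T - t)) ^ 3 * Rd (ν⁻¹ • u t x) (ν⁻¹ • fderiv ℝ (u t) x) (ν⁻¹ • fderiv ℝ (fderiv ℝ (u t)) x)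
      (ν⁻¹ • lapD (u t) x) ≤ ε

/-- Monotonicity of the quench defect in `ε`. -/
theorem HasQuenchDefectAt.mono {T : ℝ} {Λ : ℝ → ℝ} {ε ε' : ℝ} {u : ℝ → E3 → E3}
    (h : HasQuenchDefectAt T Λ ε u) (hε : ε ≤ ε') : HasQuenchDefectAt T Λ ε' u :=
  Filter.Eventually.mono h fun _ ht x hx => (ht x hx).trans hε

/-! ### The vorticity-equation dictionary: dynamic = kinematic for classical solutions -/

-- `vort_eq`: the line restates the tree's `FrozenTop.freeze_eq`; taken BY NAME (gate lint dedup.landed).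

/-- The dynamic and kinematic defects agree for classical solutions on `[0, T)`, `T > 0`. -/
theorem hasQuenchDefectAt_iff {ν T ε : ℝ} (hT : 0 < T) {Λ : ℝ → ℝ} {u : ℝ → E3 → E3} {p : ℝ → E3 → ℝ}
    (hsol : IsClassicalNSSolutionOn (Ico 0 T) ν 0 u p) :
    HasQuenchDefectAt T Λ ε u ↔ HasStretchDefectAt T Λ ν ε u := by
  refine Filter.eventually_congr ?_
  filter_upwards [Ioo_mem_nhdsLT hT] with t ht
  refine forall_congr' fun x => ?_
  rw [quench_eq hT hsol (Ioo_subset_Ico_self ht) x]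

/-- The kinematic defect is the weight-6 joint defect of `max 0 intensOf` (classical solutions on `[0, T)`, `ε ≥ 0`). -/
theorem hasStretchDefectAt_iff_joint {ν T ε : ℝ} (hν : 0 < ν) (hT : 0 < T) (hε : 0 ≤ ε) {Λ : ℝ → ℝ}
    {u : ℝ → E3 → E3} {p : ℝ → E3 → ℝ} (hsol : IsClassicalNSSolutionOn (Ico 0 T) ν 0 u p) :
    HasStretchDefectAt T Λ ν ε u ↔
      HasJointDefect₆At T Λ ν ε (fun v L H K => max 0 (intensOf v L H K)) u := by
  refine Filter.eventually_congr ?_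
  filter_upwards [Ioo_mem_nhdsLT hT] with t ht
  have h3 : ContDiff ℝ 3 (u t) :=
    (hsol.smooth_velocity.contDiff_slice (Ioo_subset_Ico_self ht)).of_le (by norm_cast)
  have hTt : 0 < (T - t) ^ 3 := pow_pos (sub_pos.2 ht.2) 3
  refine forall_congr' fun x => ?_
  refine imp_congr_right fun _ => ?_
  have e := nu_readout_intensOf hν 1 h3 x
  rw [mul_one, one_mul] at e
  rw [show (ν * (T - t)) ^ 3 = (T - t) ^ 3 * ν ^ 3 by ring, mul_assoc, mul_max_of_nonneg _ _ (pow_pos hν 3).le,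
    mul_zero, e, mul_max_le_iff hTt hε]

/-! ## §2 Calculus of zooms up to third order; the `C²_loc` tool (LINE 18) and the `C³_loc` tool (LINE 20), re-proved verbatim -/

/-! ### Hessian (`C²_loc`) convergence of Type-I mild sequences (LINE 18's extraction tool) -/

/-! ### Third-order (`C³_loc`) convergence of Type-I mild sequences (LINE 20's extraction tool) -/

/-! ## §3 The singular Type-I zoom package with Hessians and third-order data -/

/-! ## §4 THE KILL: a Type-I ancient mild solution whose vorticity magnitude does not intensify along particle paths
(`⟪ω, Δω + (ω·∇)W⟫ = ½ D_s|ω|² ≤ 0` on the open past) is ZERO — a transport / domain-of-dependence energy Liouville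
theorem: the enstrophy `Φ(σ) = ∫ |ω(σ,y)|² ψ(|y − y₀|²/Rad(σ)²) dy` in a ball that SHRINKS at the Type-I speed
(`Rad(σ) = 1 + 2C√(−σ)`, `Rad' = −C/√(−σ) ≤ −‖W(σ)‖_∞`) is non-increasing in `σ` (transport + incompressibility:
`(∂_σ + W·∇)` of the cut-off is `≤ 0` pointwise), and `Φ(σ) → 0` as `σ → −∞` by the Type-I decay of `∇W`
(`|ω|² ≲ 1/σ²` against the ball volume `≲ |σ|^{3/2}`); hence `Φ ≡ 0`, `ω ≡ 0`, and curl-free `𝒦`-slices vanish (tree). -/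

-- `norm_laplacian_curl_le`: twin of the tree's `clockAP_norm_laplacian_curl_le` (module without a farm build); used only inside §4's kill, which is taken BY NAME from the integrated-quench port — not re-declared.

/-! ## The cut-off profile `ψ` -/

/-! ## Window bounds and the gradient decay rate in `𝒦_C` -/

/-! ## The vorticity equation on the classical windows of `𝒦`: time derivative of the vorticity -/

/-! ## Continuity of the slice data -/

/-! ## The forward-shrinking cut-off `χ(σ, y) = ψ(‖y − y₀‖² / Rad(σ)²)`, `Rad(σ) = 1 + 2C√(−σ)` -/

/-! ## The cut-off enstrophy `Φ(σ) = ∫ |ω(σ, y)|² χ(σ, y) dy` is non-increasing -/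

/-! ## The far past: `Φ(σ) = O((−σ)^{-1/2})` by the scaling-sharp gradient decay -/

/-! ## The transport Liouville theorem -/

end Summit.NavierStokesRegularity.NavierStokesRegularity.Theorems.ScenarioCensus.QuenchedTop

end
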